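import Summits.HodgeConjecture.HodgeConjecture.Theorems.LinearSystemTorelliLocalTubeSpanUnimodularTransitivityLemmas
import Mathlib.RingTheory.PrincipalIdealDomain

/-!
# Route LinearSystemTorelli — crux `LocalTubeSpan` (stmt-HodgeConjecture-2490): UNI⋆ from unimodularity modulo the radical

Helper file (`--supports stmt-HodgeConjecture-2490`, line `Sketch` of the crux chain, cycle 9 wave 2,
worker W6 of continuation lead c7; the lead's stub `stub_uniStar_of_unimodular`).

Let `Λ = ℤS` be a lattice in the `ℚ`-space `V` on which the alternating form `B` is integral.  Cycle 9
proves THEOREM U — the level-2 congruence subgroup `Sp♯₂(Λ)` is generated by squares of transvections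
when `Λ` is unimodular modulo its radical — with the unimodularity hypothesis phrased as `UNI⋆`: every
`x ∈ Λ` pairing non-trivially with `Λ` is `c • x₀ + r` with `x₀ ∈ Λ` UNIMODULAR (`⟨x₀, y⟩ = 1` for some
`y ∈ Λ`), `c ∈ ℤ` and `r ∈ Λ` radical (`⟨r, Λ⟩ = 0`).  MAIN THEOREM
`localTubeSpan_uniStar_of_unimodular`: `UNI⋆` follows from the functional form of "the form induced on
`Λ/rad Λ` is unimodular", namely: every `ℚ`-linear functional that is integral on `Λ` and kills the
radical vectors of `Λ` is `⟨v, ·⟩` on `Λ` for some `v ∈ Λ`.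

Proof.  The pairing values `{⟨x, y⟩ : y ∈ Λ} ⊆ ℤ` form an ideal of `ℤ`, generated by some
`c = ⟨x, y_c⟩` (`localTubeSpan_pairingValues_principal`), non-zero as `x` is not radical.  The functional
`l = ⟨x, ·⟩ / c` is integral on `Λ` and kills radical vectors (`⟨x, r⟩ = -⟨r, x⟩ = 0`), so `l = ⟨x₀, ·⟩`
on `Λ` for some `x₀ ∈ Λ`; then `r = x - c • x₀` pairs to zero with `Λ`, and `⟨x₀, y_c⟩ = c / c = 1`.

No named facts; no `sorry`.
-/

-- `Summit.HodgeConjecture.HodgeConjecture.Theorems` is the mandated namespace (single-conjunct summit: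
-- Sub = Summit), which `linter.dupNamespace` flags on every declaration; the lakefile turns the
-- linter off tree-wide (weak option), restated here so stand-alone elaboration is warning-free too.

set_option linter.dupNamespace false

noncomputable section

open Literature.AlgebraicGeometry.HodgeTheory

namespace Summit.HodgeConjecture.HodgeConjecture.Theorems

variable {V : Type} [AddCommGroup V] [Module ℚ V]

/-! ### The ideal of pairing values of a lattice vector -/

section UniStar

/-- The pairing values `{⟨x, y⟩ : y ∈ ℤS} ⊆ ℤ` of a lattice vector `x` (integral form `B`) form an
ideal of `ℤ`, hence are exactly the multiples of one of them, `c = ⟨x, y_c⟩` (`ℤ` is a principal ideal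
ring). [folklore] -/
theorem localTubeSpan_pairingValues_principal (B : LinearMap.BilinForm ℚ V) (S : Set V)
    (hint : ∀ δ ∈ S, ∀ δ' ∈ S, ∃ n : ℤ, B δ δ' = n) {x : V} (hx : x ∈ Submodule.span ℤ S) :
    ∃ c : ℤ, (∃ y ∈ Submodule.span ℤ S, B x y = c) ∧
      ∀ y ∈ Submodule.span ℤ S, ∃ s : ℤ, B x y = c * s := by
  -- the ideal of pairing values
  let I : Ideal ℤ :=
    { carrier := {n : ℤ | ∃ y ∈ Submodule.span ℤ S, B x y = n}
      add_mem' := by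
        rintro n m ⟨y, hy, hn⟩ ⟨y', hy', hm⟩
        exact ⟨y + y', Submodule.add_mem _ hy hy', by rw [map_add, hn, hm, Int.cast_add]⟩
      zero_mem' := ⟨0, Submodule.zero_mem _, by rw [map_zero, Int.cast_zero]⟩
      smul_mem' := by
        rintro k n ⟨y, hy, hn⟩
        exact ⟨(k : ℚ) • y, localTubeSpan_intCast_smul_mem S hy k, by
          rw [map_smul, hn, smul_eq_mul, smul_eq_mul, Int.cast_mul]⟩ }
  obtain ⟨c, hc⟩ := Submodule.IsPrincipal.principal I
  refine ⟨c, ?_, fun y hy => ?_⟩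
  · -- the generator is a pairing value
    have h : c ∈ I := by
      rw [hc]
      exact Submodule.mem_span_singleton_self c
    exact h
  · -- every pairing value is a multiple of the generator
    obtain ⟨n, hn⟩ := localTubeSpan_integral_span B S hint hx hy
    have h : n ∈ I := ⟨y, hy, hn⟩
    rw [hc, Submodule.mem_span_singleton] at h
    obtain ⟨s, hs⟩ := h
    exact ⟨s, by rw [hn, ← hs, smul_eq_mul, mul_comm, Int.cast_mul]⟩

/-- `UNI⋆` FROM UNIMODULARITY MODULO THE RADICAL.  If every `ℚ`-linear functional integral on the
lattice `Λ = ℤS` and vanishing on the radical vectors of `Λ` is `⟨v, ·⟩` on `Λ` for some `v ∈ Λ` (the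
form induced by the integral alternating form `B` on `Λ/rad Λ` is unimodular), then every `x ∈ Λ`
pairing non-trivially with `Λ` is `c • x₀ + r` with `x₀ ∈ Λ` unimodular, `c ∈ ℤ` and `r ∈ Λ` radical:
`c = ⟨x, y_c⟩` generates the ideal of pairing values `⟨x, Λ⟩ ⊆ ℤ`, `x₀ ∈ Λ` represents the integral
functional `⟨x, ·⟩ / c`, which kills the radical vectors, and `⟨x₀, y_c⟩ = 1`. [folklore] -/
theorem localTubeSpan_uniStar_of_unimodular (B : LinearMap.BilinForm ℚ V) (hB : B.IsAlt) (S : Set V)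
    (hint : ∀ δ ∈ S, ∀ δ' ∈ S, ∃ n : ℤ, B δ δ' = n)
    (hunimod : ∀ l : V →ₗ[ℚ] ℚ, (∀ a ∈ Submodule.span ℤ S, ∃ z : ℤ, l a = z) →
      (∀ r ∈ Submodule.span ℤ S, (∀ y ∈ Submodule.span ℤ S, B r y = 0) → l r = 0) →
      ∃ v ∈ Submodule.span ℤ S, ∀ a ∈ Submodule.span ℤ S, l a = B v a)
    {x : V} (hx : x ∈ Submodule.span ℤ S) (hxnr : ∃ y ∈ Submodule.span ℤ S, B x y ≠ 0) :
    ∃ x₀ ∈ Submodule.span ℤ S, ∃ c : ℤ, ∃ r ∈ Submodule.span ℤ S,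
      (∀ y ∈ Submodule.span ℤ S, B r y = 0) ∧ x = (c : ℚ) • x₀ + r ∧
      ∃ y ∈ Submodule.span ℤ S, B x₀ y = 1 := by
  -- the generator `c = ⟨x, y_c⟩` of the ideal of pairing values of `x`
  obtain ⟨c, ⟨yc, hyc, hc⟩, hmul⟩ := localTubeSpan_pairingValues_principal B S hint hx
  -- `c ≠ 0`, as `x` pairs non-trivially with the lattice
  have hc0 : (c : ℚ) ≠ 0 := by
    obtain ⟨y, hy, hxy⟩ := hxnr
    obtain ⟨s, hs⟩ := hmul y hy
    intro h
    rw [hs, h, zero_mul] at hxy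
    exact hxy rfl
  -- the functional `⟨x, ·⟩ / c` is integral on `ℤS` and kills its radical vectors: it is `⟨x₀, ·⟩`
  obtain ⟨x₀, hx₀, hl⟩ := hunimod ((c : ℚ)⁻¹ • B x)
    (fun a ha => by
      obtain ⟨s, hs⟩ := hmul a ha
      exact ⟨s, by rw [LinearMap.smul_apply, hs, smul_eq_mul, inv_mul_cancel_left₀ hc0]⟩)
    (fun r _ hr => by
      rw [LinearMap.smul_apply, ← hB.neg_eq, hr x hx, neg_zero, smul_zero])
  simp only [LinearMap.smul_apply, smul_eq_mul] at hl
  refine ⟨x₀, hx₀, c, x - (c : ℚ) • x₀,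
    Submodule.sub_mem _ hx (localTubeSpan_intCast_smul_mem S hx₀ c), fun y hy => ?_, ?_,
    yc, hyc, ?_⟩
  · -- `r = x - c • x₀` pairs to zero with the lattice
    rw [map_sub, map_smul, LinearMap.sub_apply, LinearMap.smul_apply, ← hl y hy, smul_eq_mul,
      mul_inv_cancel_left₀ hc0, sub_self]
  · -- `x = c • x₀ + r`
    abel
  · -- `x₀` is unimodular: `⟨x₀, y_c⟩ = c / c = 1`
    rw [← hl yc hyc, hc, inv_mul_cancel₀ hc0]

end UniStar

end Summit.HodgeConjecture.HodgeConjecture.Theorems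

end
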